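import Summits.BirchSwinnertonDyer.BirchSwinnertonDyer.Theorems.KimAtThreeDeepLowerOffStratumNonAdditiveRows
import Summits.BirchSwinnertonDyer.BirchSwinnertonDyer.Theorems.KimAtThreeDeepLowerOffStratumAdditiveDefect
import Summits.BirchSwinnertonDyer.BirchSwinnertonDyer.Theorems.KimAtThreeDeepLowerTamagawaLevelLoweringField
import Summits.BirchSwinnertonDyer.BirchSwinnertonDyer.Theorems.KimAtThreeDeepLowerSplitGlue
import HarnessLib

/-!
# Route `KimAtThreeKolyvagin` (rung W2), crux `DeepLowerAtThreeOffKatoStratum` (item 19679, §L child of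
# `DeepLowerAtThree` 19075): the OWNER'S ASSEMBLY — the crux BY NAME modulo its displayed residuals

Cell `bsd-addord`, seat `bsd-addord-w2-c2` (gen 4, OWNER of `stmt-BirchSwinnertonDyer-19679`). The BC3 birth
skeleton (`HOME/planner/splitW2L/bc/DeepLowerAtThreeOffKatoStratum_birth.lean`, sha16 `e575d03075635394`)
composes the crux from `stub_nonAdditive` (hand acc2) and `stub_additiveDefect` (hand acc3) by a case split
on `Addv W₀ 3`. Neither stub is closed — as universal statements they cannot be today: the LOWER half of
`BSD₃` is not in print at good SUPERSINGULAR `3` or at multiplicative `3` without (ram) under surj(3), the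
additive lower halves are the cell's own open rows (`N10.LowerHalfM`, `PotGoodLowerHalfRankZero`), and
«Tamagawa divisibility of (deep) Kurihara numbers» (Kim 2022 Conj. 1.10 `≥`) is open beyond what the
level-lowering road of `KimAtThreeDeepLowerTamagawaLevelLowering` feeds. This file is the composition
`DeepLowerAtThreeOffKatoStratum_of` run on the two hands' STUB-SHAPED theorems, so that the crux stands in
the tree BY NAME with its residual DISPLAYED exactly (the planner's 2026-08-28 residual text reads it here):

* `deepLowerAtThreeOffKatoStratum_of_lowerHalves_of_tamDiv` — **the crux ⟸ GZK + Mazur 1978 Cor. 4.1 +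
  FIVE displayed binders**: (L) Miller's lower half `MissingLowerBoundAt W 3` on the non-additive tower rows
  of analytic rank `0`; (TD) TamDiv-deep `v₃(∏ c_ℓ) ≤ ∂^{(∞)}_{deep}(δ̃)` on those rows with `3 ∣ ∏ c_ℓ`;
  (M) `N10.LowerHalfM`; (G) `PotGoodLowerHalfRankZero`; (TMD) Tamagawa–Manin divisibility
  `v₃(∏ c_ℓ) + v₃(c_{D₀}) ≤ ∂^{(∞)}_{deep}` on the additive optimal tower rows — verbatim acc2's
  `stub_nonAdditive_of_missingLowerBoundAt_of_tamagawa_le_deepInfty` (p455574-family) and acc3's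
  `stubAdditiveDefect_of_lowerHalves_of_tamManinDiv` (p459409) composed as in the skeleton.
* `deepLowerAtThreeOffKatoStratum_of_facts_of_residuals` — **the same with everything in print plugged in**:
  named facts Yan–Zhu 2026 Thm. 4.15 (`hYZ`, PUB*, flag `YZ26@3`), Wuthrich 2014 L20 (`hW20`), Skinner 2016
  Thm. C (`hSk`), modularity (`hmod`), GZK, Mazur Cor. 4.1 (`hMaz`) discharge (L) on the COVERED rows (good
  ordinary / multiplicative (ram), acc2's `missingLowerBoundAt_three_covered`), and the level-lowering road
  (this seat, parts 1–4) feeds (TD) from a displayed «stabilised level-lowering congruence supply» (LL) at the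
  Tamagawa exponent; RESIDUAL displayed binders: (L′) the lower half of `BSD₃` on the UNCOVERED non-additive
  tower rows (good supersingular `3`; multiplicative `3` without (ram)); (LL) for every non-additive optimal
  tower row with `3 ∣ ∏ c_ℓ`, a congruence `[x]⁺ ≡ u(φ(x) − φ(qx)) mod 3^m` with `v₃(∏ c_ℓ) ≤ m` (IN PRINT for
  `m = 1`: Ribet 1990 + mod-`3` multiplicity one + Vatsal 1999, untyped); (M), (G), (TMD) as above.

HONEST FRAMING. Theorems only; no definition, no named fact, no `sorry`; the two theorems conclude the route
decl `Summit.BirchSwinnertonDyer.BirchSwinnertonDyer.Theses.KimAtThreeKolyvagin.DeepLowerAtThreeOffKatoStratum`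
BY NAME but UNDER HYPOTHESES — they are CONDITIONAL and do NOT close item 19679 (landed `--supports … --as
helper`); crux 19679 stays OPEN; BSD is not proved by any of this.

References: [YanZhu2024MainConjNonCM] Thm. 4.15; [Wuthrich2014] Lemma 20; [Skinner2016PacificMC] Thm. C;
[Mazur1978] Cor. 4.1; [Miller2011LMS] Def. 1.1; [Kim2022StructureSelmer] Conj. 1.10, Thm. 1.9 (6);
[Kim2025RefinedTNC] Thm. 1.1, §8.1.2; [Delbourgo1998] Main Conjecture; [Kato2004Asterisque] Conj. 12.10;
[Ribet1990] Thm. 1.1; [Ota2018] Prop. 2.3 (1).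
-/

set_option autoImplicit false
-- the Theorems namespace of a single-conjunct summit repeats the summit name by design (D-0017)
set_option linter.dupNamespace false

noncomputable section

open scoped MatrixGroups ModularForm Classical

open Literature.NumberTheory.DiophantineGeometry.Dioph (ratModP)
open CongruenceSubgroup WeierstrassCurve Literature.NumberTheory.EllipticCurves
  Literature.NumberTheory.EllipticCurves.ModularForms
  Literature.NumberTheory.EllipticCurves.Rank1Residual
  Literature.NumberTheory.EllipticCurves.Rank1Residual.Typed

namespace Summit.BirchSwinnertonDyer.BirchSwinnertonDyer.Theorems.KimAtThreeDeepLowerOffKatoStratumAssembly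

open Summit.BirchSwinnertonDyer.Rank1Residual
open Summit.BirchSwinnertonDyer.Rank1Residual.Additive
open Summit.BirchSwinnertonDyer.BirchSwinnertonDyer.Theses.KimAtThreeKolyvagin
open Summit.BirchSwinnertonDyer.BirchSwinnertonDyer.Theorems.KimAtThreeKolyvaginUnitLevelOneRungs
open Summit.BirchSwinnertonDyer.BirchSwinnertonDyer.Theorems.KimAtThreeDeepLowerNonAdditiveRows
open Summit.BirchSwinnertonDyer.BirchSwinnertonDyer.Theorems.KimAtThreeDeepLowerSmallDefect
open Summit.BirchSwinnertonDyer.BirchSwinnertonDyer.Theorems.KimAtThreeShallowEqDeepOffStratumNonAdditiveRows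
open Summit.BirchSwinnertonDyer.BirchSwinnertonDyer.Theorems.KimAtThreeDeepLowerOffStratumSockets
open Summit.BirchSwinnertonDyer.BirchSwinnertonDyer.Theorems.KimAtThreeDeepLowerOffStratumNonAdditiveRows
open Summit.BirchSwinnertonDyer.BirchSwinnertonDyer.Theorems.KimAtThreeDeepLowerOffStratumAdditiveDefect
open Summit.BirchSwinnertonDyer.BirchSwinnertonDyer.Theorems.KimAtThreeDeepLowerTamagawaLevelLowering

/-- **Crux 19679 `DeepLowerAtThreeOffKatoStratum` BY NAME, modulo GZK, Mazur 1978 Cor. 4.1 and FIVE displayed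
binders** — the skeleton's composition `DeepLowerAtThreeOffKatoStratum_of` run on acc2's
`stub_nonAdditive_of_missingLowerBoundAt_of_tamagawa_le_deepInfty` (non-additive rows: (L) lower half of
`BSD₃`, (TD) TamDiv-deep) and acc3's `stubAdditiveDefect_of_lowerHalves_of_tamManinDiv` (additive rows:
(M) `N10.LowerHalfM`, (G) `PotGoodLowerHalfRankZero`, (TMD) Tamagawa–Manin divisibility). CONDITIONAL: does
not close the item. [cite: Kim2022StructureSelmer, Conj. 1.10 (PDF p. 8), Thm. 1.9 (6)] [cite: Miller2011LMS, Def. 1.1]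
[cite: Mazur1978, Cor. 4.1] [cite: Delbourgo1998, Main Conjecture (p. 151)] [cite: Kato2004Asterisque, Conj. 12.10 (p. 224)] -/
theorem deepLowerAtThreeOffKatoStratum_of_lowerHalves_of_tamDiv
    (hGZK : rank_eq_analyticRank_of_analyticRank_le_one) (hMaz : mazur_not_dvd_maninConstant_of_odd)
    (hL : ∀ (W : WeierstrassCurve ℚ) [W.IsElliptic] [W.IsGloballyMinimal],
      (∀ n : ℕ, W.HasSurjectiveModNGaloisRep (3 ^ n : ℕ)) → W.analyticRank = 0 →
      ¬ (haveI : Fact (Nat.Prime 3) := ⟨Nat.prime_three⟩; Addv W 3) → MissingLowerBoundAt W 3)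
    (hTD : ∀ (W : WeierstrassCurve ℚ) [W.IsElliptic] [W.IsGloballyMinimal],
      (∀ n : ℕ, W.HasSurjectiveModNGaloisRep (3 ^ n : ℕ)) →
      ∀ {N : ℕ} [NeZero N] (f : CuspForm (Gamma0 N) 2), IsNewformOf W f →
      kuriharaVanishingOrder W 3 f = 0 →
      ¬ (haveI : Fact (Nat.Prime 3) := ⟨Nat.prime_three⟩; Addv W 3) → 3 ∣ W.tamagawaProduct →
        ((padicValNat 3 W.tamagawaProduct : ℕ) : ℕ∞) ≤ kuriharaPartialDeepInfty W 3 f)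
    (hM : N10.LowerHalfM) (hG : PotGoodLowerHalfRankZero)
    (hTMD : ∀ (W₀ : WeierstrassCurve ℚ) [W₀.IsElliptic] [W₀.IsGloballyMinimal],
      (∀ n : ℕ, W₀.HasSurjectiveModNGaloisRep (3 ^ n : ℕ)) →
      ∀ {N : ℕ} [NeZero N], N = W₀.conductorNorm ℤ → ∀ (D₀ : ModularParametrizationData W₀ N),
        (∀ z ∈ D₀.L.lattice, ∃ w ∈ periodLattice D₀.f, z = D₀.c * w) →
        (∀ (W₂ : WeierstrassCurve ℚ) [W₂.IsElliptic] (D₂ : ModularParametrizationData W₂ N),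
          D₂.f = D₀.f → D₀.modularDegree ≤ D₂.modularDegree) →
        kuriharaVanishingOrder W₀ 3 D₀.f = 0 →
        (haveI : Fact (Nat.Prime 3) := ⟨Nat.prime_three⟩; Addv W₀ 3) →
        ((padicValNat 3 W₀.tamagawaProduct + padicValInt 3 D₀.maninConstant : ℕ) : ℕ∞) ≤
          kuriharaPartialDeepInfty W₀ 3 D₀.f) :
    Summit.BirchSwinnertonDyer.BirchSwinnertonDyer.Theses.KimAtThreeKolyvagin.DeepLowerAtThreeOffKatoStratum := by
  intro W₀ _ _ htow hfin N _ hN D₀ hopt hdeg hint hord hoff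
  by_cases hA : (haveI : Fact (Nat.Prime 3) := ⟨Nat.prime_three⟩; Addv W₀ 3)
  · refine stubAdditiveDefect_of_lowerHalves_of_tamManinDiv hGZK hM hG hTMD W₀ htow hfin hN D₀ hopt hdeg
      hint hord hA ?_
    by_contra hcon
    push Not at hcon
    exact hoff ⟨hA, hcon.1, hcon.2.1, hcon.2.2⟩
  · exact stub_nonAdditive_of_missingLowerBoundAt_of_tamagawa_le_deepInfty hMaz hGZK hL hTD W₀ htow hfin hN
      D₀ hopt hdeg hint hord hA

/-- **Crux 19679 BY NAME with the printed inputs plugged in — the residual displayed exactly.** Named facts: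
`hYZ` (Yan–Zhu 2026 Thm. 4.15), `hW20`, `hSk` (Skinner 2016 Thm. C), `hmod`, `hGZK`, `hMaz`; open NAMED rows:
(M) `N10.LowerHalfM`, (G) `PotGoodLowerHalfRankZero`; RESIDUAL displayed binders: (L′) Miller's lower half on
the UNCOVERED non-additive tower rows of analytic rank `0` (good `3` with `3 ∣ a₃`, or multiplicative `3`
without (ram)); (LL) on every non-additive optimal tower row with `3 ∣ ∏ c_ℓ`, a stabilised level-lowering
congruence of depth `m ≥ v₃(∏ c_ℓ)` (feeds TamDiv-deep by `tamagawa_le_kuriharaPartialInfty_of_stabilisedCongruence`);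
(TMD) on the additive rows. CONDITIONAL: does not close the item. [cite: YanZhu2024MainConjNonCM, Thm. 4.15 (§4.6)]
[cite: Skinner2016PacificMC, Thm. C (§1)] [cite: Mazur1978, Cor. 4.1] [cite: Ribet1990, Thm. 1.1]
[cite: Ota2018, Prop. 2.3 (1)] [cite: Kim2022StructureSelmer, Conj. 1.10 (PDF p. 8)] -/
theorem deepLowerAtThreeOffKatoStratum_of_facts_of_residuals
    (hYZ : YanZhu2026.thm415_padicValRat_bsd_rank_le_one)
    (hW20 : Wuthrich2014.lemma20_surjective_threeAdic_of_semistable)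
    (hSk : Skinner2016.thmC_padicValRat_bsd_rank_zero)
    (hmod : hasEntireLFunction_rat) (hGZK : rank_eq_analyticRank_of_analyticRank_le_one)
    (hMaz : mazur_not_dvd_maninConstant_of_odd)
    (hL' : ∀ (W : WeierstrassCurve ℚ) [W.IsElliptic] [W.IsGloballyMinimal],
      (∀ n : ℕ, W.HasSurjectiveModNGaloisRep (3 ^ n : ℕ)) → W.analyticRank = 0 →
      ¬ (haveI : Fact (Nat.Prime 3) := ⟨Nat.prime_three⟩; Addv W 3) →
      ((W.HasGoodReductionAtPrime 3 ∧ (3 : ℤ) ∣ W.frobeniusTrace 3) ∨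
        (W.HasMultiplicativeReductionAtPrime 3 ∧
          ¬ (haveI : Fact (Nat.Prime 3) := ⟨Nat.prime_three⟩; Ram W 3))) →
      MissingLowerBoundAt W 3)
    (hLL : ∀ (W₀ : WeierstrassCurve ℚ) [W₀.IsElliptic] [W₀.IsGloballyMinimal],
      (∀ n : ℕ, W₀.HasSurjectiveModNGaloisRep (3 ^ n : ℕ)) →
      ∀ {N : ℕ} [NeZero N], N = W₀.conductorNorm ℤ → ∀ (D₀ : ModularParametrizationData W₀ N),
        (∀ z ∈ D₀.L.lattice, ∃ w ∈ periodLattice D₀.f, z = D₀.c * w) →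
        kuriharaVanishingOrder W₀ 3 D₀.f = 0 →
        ¬ (haveI : Fact (Nat.Prime 3) := ⟨Nat.prime_three⟩; Addv W₀ 3) → 3 ∣ W₀.tamagawaProduct →
        ∃ m : ℕ, padicValNat 3 W₀.tamagawaProduct ≤ m ∧ ∃ q : ℕ, q ∣ W₀.conductorNorm ℤ * 3 ∧
          ∃ (u : ZMod (3 ^ m)) (φ : ℚ → ZMod (3 ^ m)), (∀ x, φ (x + 1) = φ x) ∧
            (∀ ℓ : ℕ, ℓ.Prime → ¬ ℓ ∣ W₀.conductorNorm ℤ * 3 → ∀ x : ℚ,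
              (W₀.frobeniusTrace ℓ : ZMod (3 ^ m)) * φ x = (∑ j : Fin ℓ, φ ((x + j) / ℓ)) + φ (ℓ * x)) ∧
            (∀ x : ℚ, ratModP (3 ^ m) (ratPlusSymbol D₀.f x) = u * (φ x - φ (q * x))))
    (hM : N10.LowerHalfM) (hG : PotGoodLowerHalfRankZero)
    (hTMD : ∀ (W₀ : WeierstrassCurve ℚ) [W₀.IsElliptic] [W₀.IsGloballyMinimal],
      (∀ n : ℕ, W₀.HasSurjectiveModNGaloisRep (3 ^ n : ℕ)) →
      ∀ {N : ℕ} [NeZero N], N = W₀.conductorNorm ℤ → ∀ (D₀ : ModularParametrizationData W₀ N),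
        (∀ z ∈ D₀.L.lattice, ∃ w ∈ periodLattice D₀.f, z = D₀.c * w) →
        (∀ (W₂ : WeierstrassCurve ℚ) [W₂.IsElliptic] (D₂ : ModularParametrizationData W₂ N),
          D₂.f = D₀.f → D₀.modularDegree ≤ D₂.modularDegree) →
        kuriharaVanishingOrder W₀ 3 D₀.f = 0 →
        (haveI : Fact (Nat.Prime 3) := ⟨Nat.prime_three⟩; Addv W₀ 3) →
        ((padicValNat 3 W₀.tamagawaProduct + padicValInt 3 D₀.maninConstant : ℕ) : ℕ∞) ≤
          kuriharaPartialDeepInfty W₀ 3 D₀.f) :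
    Summit.BirchSwinnertonDyer.BirchSwinnertonDyer.Theses.KimAtThreeKolyvagin.DeepLowerAtThreeOffKatoStratum := by
  intro W₀ _ _ htow hfin N _ hN D₀ hopt hdeg hint hord hoff
  haveI : Fact (Nat.Prime 3) := ⟨Nat.prime_three⟩
  by_cases hA : Addv W₀ 3
  · refine stubAdditiveDefect_of_lowerHalves_of_tamManinDiv hGZK hM hG hTMD W₀ htow hfin hN D₀ hopt hdeg
      hint hord hA ?_
    by_contra hcon
    push Not at hcon
    exact hoff ⟨hA, hcon.1, hcon.2.1, hcon.2.2⟩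
  · -- non-additive row: lower half (covered by name / uncovered displayed) + TamDiv-deep from (LL)
    have hf : IsNewformOf W₀ D₀.f := D₀.isNewformOf
    have hr0 : W₀.analyticRank = 0 :=
      analyticRank_eq_zero_of_kuriharaVanishingOrder_eq_zero W₀ D₀.f hf hord
    have hirr : W₀.HasIrreducibleModPGaloisRep 3 :=
      hasIrreducibleModPGaloisRep_of_hasSurjectiveModNGaloisRep W₀ 3 (by simpa using htow 1)
    have hper := periodTransfer_three_of_optimal_of_not_addv W₀ hMaz hN D₀ hopt hA
    have hlow : MissingLowerBoundAt W₀ 3 := by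
      by_cases hcov : (W₀.HasGoodReductionAtPrime 3 → ¬ (3 : ℤ) ∣ W₀.frobeniusTrace 3) ∧
          (W₀.HasMultiplicativeReductionAtPrime 3 → Ram W₀ 3)
      · exact missingLowerBoundAt_three_covered W₀ hYZ hW20 hSk hmod hGZK htow hr0 hA hcov.1 hcov.2
      · refine hL' W₀ htow hr0 hA ?_
        by_contra hunc
        push Not at hunc
        exact hcov hunc
    have htam : ((padicValNat 3 W₀.tamagawaProduct : ℕ) : ℕ∞) ≤ kuriharaPartialDeepInfty W₀ 3 D₀.f := by
      by_cases h3 : 3 ∣ W₀.tamagawaProduct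
      · obtain ⟨m, hv, q, hq, u, φ, hperφ, hφH, hC⟩ := hLL W₀ htow hN D₀ hopt hord hA h3
        exact (tamagawa_le_kuriharaPartialInfty_of_stabilisedCongruence W₀ 3 m D₀.f hint hv q hq u φ hperφ
          hφH hC).2
      · rw [padicValNat.eq_zero_of_not_dvd h3, Nat.cast_zero]
        exact zero_le
    exact deepLower_conclusion_of_missingLowerBoundAt_of_tamagawa_le_deepInfty W₀ 3 D₀.f hGZK (by norm_num)
      hirr hf hord hper hlow htam

/-- **Crux 19679 BY NAME — the residual at the finest grain the tree affords today.** As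
`deepLowerAtThreeOffKatoStratum_of_facts_of_residuals`, but the Tamagawa rows are split by exponent: on the
non-additive optimal tower rows with EXACTLY ONE factor `3` in `∏ c_ℓ` the input is the FIELD-valued depth-`1`
congruence (LL₁^F) — the shape of the Literature fact «Ribet 1990 + mod-`3` multiplicity one + Vatsal 1999»
being typed (cell WANTED (2), 2026-08-26) — consumed through part 4
(`tamagawa_le_kuriharaPartialInfty_of_stabilisedCongruence_field`); on the rows with `9 ∣ ∏ c_ℓ` TamDiv-deep
stays displayed as (TD₂). RESIDUAL = {(L′), (LL₁^F) [in print, untyped], (TD₂), (M), (G), (TMD)}. CONDITIONAL: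
does not close the item. [cite: Ribet1990, Thm. 1.1] [cite: YanZhu2024MainConjNonCM, Thm. 4.15 (§4.6)]
[cite: Skinner2016PacificMC, Thm. C (§1)] [cite: Mazur1978, Cor. 4.1] [cite: Kim2022StructureSelmer, Conj. 1.10 (PDF p. 8)] -/
theorem deepLowerAtThreeOffKatoStratum_of_facts_of_residuals_field
    (hYZ : YanZhu2026.thm415_padicValRat_bsd_rank_le_one)
    (hW20 : Wuthrich2014.lemma20_surjective_threeAdic_of_semistable)
    (hSk : Skinner2016.thmC_padicValRat_bsd_rank_zero)
    (hmod : hasEntireLFunction_rat) (hGZK : rank_eq_analyticRank_of_analyticRank_le_one)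
    (hMaz : mazur_not_dvd_maninConstant_of_odd)
    (hL' : ∀ (W : WeierstrassCurve ℚ) [W.IsElliptic] [W.IsGloballyMinimal],
      (∀ n : ℕ, W.HasSurjectiveModNGaloisRep (3 ^ n : ℕ)) → W.analyticRank = 0 →
      ¬ (haveI : Fact (Nat.Prime 3) := ⟨Nat.prime_three⟩; Addv W 3) →
      ((W.HasGoodReductionAtPrime 3 ∧ (3 : ℤ) ∣ W.frobeniusTrace 3) ∨
        (W.HasMultiplicativeReductionAtPrime 3 ∧
          ¬ (haveI : Fact (Nat.Prime 3) := ⟨Nat.prime_three⟩; Ram W 3))) →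
      MissingLowerBoundAt W 3)
    (hLL1 : ∀ (W₀ : WeierstrassCurve ℚ) [W₀.IsElliptic] [W₀.IsGloballyMinimal],
      (∀ n : ℕ, W₀.HasSurjectiveModNGaloisRep (3 ^ n : ℕ)) →
      ∀ {N : ℕ} [NeZero N], N = W₀.conductorNorm ℤ → ∀ (D₀ : ModularParametrizationData W₀ N),
        (∀ z ∈ D₀.L.lattice, ∃ w ∈ periodLattice D₀.f, z = D₀.c * w) →
        kuriharaVanishingOrder W₀ 3 D₀.f = 0 →
        ¬ (haveI : Fact (Nat.Prime 3) := ⟨Nat.prime_three⟩; Addv W₀ 3) →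
        padicValNat 3 W₀.tamagawaProduct = 1 →
        ∃ q : ℕ, q ∣ W₀.conductorNorm ℤ * 3 ∧ ∃ (F : Type) (_ : Field F) (ι : ZMod (3 ^ 1) →+* F) (u : F)
          (φ : ℚ → F), (∀ x, φ (x + 1) = φ x) ∧
            (∀ ℓ : ℕ, ℓ.Prime → ¬ ℓ ∣ W₀.conductorNorm ℤ * 3 → ∀ x : ℚ,
              ι (W₀.frobeniusTrace ℓ : ZMod (3 ^ 1)) * φ x = (∑ j : Fin ℓ, φ ((x + j) / ℓ)) + φ (ℓ * x)) ∧
            (∀ x : ℚ, ι (ratModP (3 ^ 1) (ratPlusSymbol D₀.f x)) = u * (φ x - φ (q * x))))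
    (hTD2 : ∀ (W₀ : WeierstrassCurve ℚ) [W₀.IsElliptic] [W₀.IsGloballyMinimal],
      (∀ n : ℕ, W₀.HasSurjectiveModNGaloisRep (3 ^ n : ℕ)) →
      ∀ {N : ℕ} [NeZero N], N = W₀.conductorNorm ℤ → ∀ (D₀ : ModularParametrizationData W₀ N),
        (∀ z ∈ D₀.L.lattice, ∃ w ∈ periodLattice D₀.f, z = D₀.c * w) →
        kuriharaVanishingOrder W₀ 3 D₀.f = 0 →
        ¬ (haveI : Fact (Nat.Prime 3) := ⟨Nat.prime_three⟩; Addv W₀ 3) → 9 ∣ W₀.tamagawaProduct →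
        ((padicValNat 3 W₀.tamagawaProduct : ℕ) : ℕ∞) ≤ kuriharaPartialDeepInfty W₀ 3 D₀.f)
    (hM : N10.LowerHalfM) (hG : PotGoodLowerHalfRankZero)
    (hTMD : ∀ (W₀ : WeierstrassCurve ℚ) [W₀.IsElliptic] [W₀.IsGloballyMinimal],
      (∀ n : ℕ, W₀.HasSurjectiveModNGaloisRep (3 ^ n : ℕ)) →
      ∀ {N : ℕ} [NeZero N], N = W₀.conductorNorm ℤ → ∀ (D₀ : ModularParametrizationData W₀ N),
        (∀ z ∈ D₀.L.lattice, ∃ w ∈ periodLattice D₀.f, z = D₀.c * w) →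
        (∀ (W₂ : WeierstrassCurve ℚ) [W₂.IsElliptic] (D₂ : ModularParametrizationData W₂ N),
          D₂.f = D₀.f → D₀.modularDegree ≤ D₂.modularDegree) →
        kuriharaVanishingOrder W₀ 3 D₀.f = 0 →
        (haveI : Fact (Nat.Prime 3) := ⟨Nat.prime_three⟩; Addv W₀ 3) →
        ((padicValNat 3 W₀.tamagawaProduct + padicValInt 3 D₀.maninConstant : ℕ) : ℕ∞) ≤
          kuriharaPartialDeepInfty W₀ 3 D₀.f) :
    Summit.BirchSwinnertonDyer.BirchSwinnertonDyer.Theses.KimAtThreeKolyvagin.DeepLowerAtThreeOffKatoStratum := by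
  intro W₀ _ _ htow hfin N _ hN D₀ hopt hdeg hint hord hoff
  haveI : Fact (Nat.Prime 3) := ⟨Nat.prime_three⟩
  by_cases hA : Addv W₀ 3
  · refine stubAdditiveDefect_of_lowerHalves_of_tamManinDiv hGZK hM hG hTMD W₀ htow hfin hN D₀ hopt hdeg
      hint hord hA ?_
    by_contra hcon
    push Not at hcon
    exact hoff ⟨hA, hcon.1, hcon.2.1, hcon.2.2⟩
  · have hf : IsNewformOf W₀ D₀.f := D₀.isNewformOf
    have hr0 : W₀.analyticRank = 0 :=
      analyticRank_eq_zero_of_kuriharaVanishingOrder_eq_zero W₀ D₀.f hf hord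
    have hirr : W₀.HasIrreducibleModPGaloisRep 3 :=
      hasIrreducibleModPGaloisRep_of_hasSurjectiveModNGaloisRep W₀ 3 (by simpa using htow 1)
    have hper := periodTransfer_three_of_optimal_of_not_addv W₀ hMaz hN D₀ hopt hA
    have hlow : MissingLowerBoundAt W₀ 3 := by
      by_cases hcov : (W₀.HasGoodReductionAtPrime 3 → ¬ (3 : ℤ) ∣ W₀.frobeniusTrace 3) ∧
          (W₀.HasMultiplicativeReductionAtPrime 3 → Ram W₀ 3)
      · exact missingLowerBoundAt_three_covered W₀ hYZ hW20 hSk hmod hGZK htow hr0 hA hcov.1 hcov.2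
      · refine hL' W₀ htow hr0 hA ?_
        by_contra hunc
        push Not at hunc
        exact hcov hunc
    have htam : ((padicValNat 3 W₀.tamagawaProduct : ℕ) : ℕ∞) ≤ kuriharaPartialDeepInfty W₀ 3 D₀.f := by
      by_cases h3 : 3 ∣ W₀.tamagawaProduct
      · by_cases h9 : 9 ∣ W₀.tamagawaProduct
        · exact hTD2 W₀ htow hN D₀ hopt hord hA h9
        · -- exactly one factor `3`
          have hne : W₀.tamagawaProduct ≠ 0 := fun h0 => h9 (h0 ▸ dvd_zero 9)
          have hv1 : padicValNat 3 W₀.tamagawaProduct = 1 := by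
            have hge : 1 ≤ padicValNat 3 W₀.tamagawaProduct := one_le_padicValNat_of_dvd hne h3
            have hlt : padicValNat 3 W₀.tamagawaProduct < 2 := by
              by_contra hle
              push Not at hle
              exact h9 (by
                have := pow_padicValNat_dvd (p := 3) (n := W₀.tamagawaProduct)
                exact dvd_trans (pow_dvd_pow 3 hle) this)
            omega
          obtain ⟨q, hq, F, _, ι, u, φ, hperφ, hφH, hC⟩ := hLL1 W₀ htow hN D₀ hopt hord hA hv1
          exact (KimAtThreeDeepLowerTamagawaLevelLoweringField.tamagawa_le_kuriharaPartialInfty_of_stabilisedCongruence_field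
            W₀ 3 D₀.f hv1.le q hq ι u φ hperφ hφH hC).2
      · rw [padicValNat.eq_zero_of_not_dvd h3, Nat.cast_zero]
        exact zero_le
    exact deepLower_conclusion_of_missingLowerBoundAt_of_tamagawa_le_deepInfty W₀ 3 D₀.f hGZK (by norm_num)
      hirr hf hord hper hlow htam

/-- **The PARENT crux 19075 `DeepLowerAtThree` BY NAME, modulo its complete displayed residual** — the §L glue
(item 19680, CLOSED; here through p441486 `KimAtThreeDeepLowerSplitGlue.deepLowerAtThree_of_parts`) composed with the owner's
assembly of the off-stratum child: `DeepLowerAtThree` ⟸ the five-part alias `KatoStratumSharedParts` (item 19678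
= Sakamoto 2024 Thm. 4.4 ×2 ∧ GZK ∧ Poitou–Tate ∧ Carayol ∧ the shared PORT″ crux 19560) ∧ Mazur 1978 Cor. 4.1
∧ the five displayed off-stratum binders (L), (TD), (M), (G), (TMD) of
`deepLowerAtThreeOffKatoStratum_of_lowerHalves_of_tamDiv`. So the residual of 19075 in the tree is EXACTLY
{19560 (PORT″: C1 fine Kato package + C3 anomalous bad places), (L), (TD), (M), (G), (TMD)}. CONDITIONAL: does
not close any item. [cite: Kim2025RefinedTNC, Thm. 1.1] [cite: Sakamoto2024, Thm. 4.4 (p. 926)]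
[cite: Kim2022StructureSelmer, Conj. 1.10 (PDF p. 8)] [cite: Mazur1978, Cor. 4.1] -/
theorem deepLowerAtThree_of_katoStratumSharedParts_of_residuals
    (hK : KatoStratumSharedParts) (hMaz : mazur_not_dvd_maninConstant_of_odd)
    (hL : ∀ (W : WeierstrassCurve ℚ) [W.IsElliptic] [W.IsGloballyMinimal],
      (∀ n : ℕ, W.HasSurjectiveModNGaloisRep (3 ^ n : ℕ)) → W.analyticRank = 0 →
      ¬ (haveI : Fact (Nat.Prime 3) := ⟨Nat.prime_three⟩; Addv W 3) → MissingLowerBoundAt W 3)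
    (hTD : ∀ (W : WeierstrassCurve ℚ) [W.IsElliptic] [W.IsGloballyMinimal],
      (∀ n : ℕ, W.HasSurjectiveModNGaloisRep (3 ^ n : ℕ)) →
      ∀ {N : ℕ} [NeZero N] (f : CuspForm (Gamma0 N) 2), IsNewformOf W f →
      kuriharaVanishingOrder W 3 f = 0 →
      ¬ (haveI : Fact (Nat.Prime 3) := ⟨Nat.prime_three⟩; Addv W 3) → 3 ∣ W.tamagawaProduct →
        ((padicValNat 3 W.tamagawaProduct : ℕ) : ℕ∞) ≤ kuriharaPartialDeepInfty W 3 f)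
    (hM : N10.LowerHalfM) (hG : PotGoodLowerHalfRankZero)
    (hTMD : ∀ (W₀ : WeierstrassCurve ℚ) [W₀.IsElliptic] [W₀.IsGloballyMinimal],
      (∀ n : ℕ, W₀.HasSurjectiveModNGaloisRep (3 ^ n : ℕ)) →
      ∀ {N : ℕ} [NeZero N], N = W₀.conductorNorm ℤ → ∀ (D₀ : ModularParametrizationData W₀ N),
        (∀ z ∈ D₀.L.lattice, ∃ w ∈ periodLattice D₀.f, z = D₀.c * w) →
        (∀ (W₂ : WeierstrassCurve ℚ) [W₂.IsElliptic] (D₂ : ModularParametrizationData W₂ N),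
          D₂.f = D₀.f → D₀.modularDegree ≤ D₂.modularDegree) →
        kuriharaVanishingOrder W₀ 3 D₀.f = 0 →
        (haveI : Fact (Nat.Prime 3) := ⟨Nat.prime_three⟩; Addv W₀ 3) →
        ((padicValNat 3 W₀.tamagawaProduct + padicValInt 3 D₀.maninConstant : ℕ) : ℕ∞) ≤
          kuriharaPartialDeepInfty W₀ 3 D₀.f) :
    Summit.BirchSwinnertonDyer.BirchSwinnertonDyer.Theses.KimAtThreeKolyvagin.DeepLowerAtThree := by
  obtain ⟨hSak, hGZK, hPT, hlev, hPort⟩ := hK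
  exact KimAtThreeDeepLowerSplitGlue.deepLowerAtThree_of_parts hSak hGZK hPT hlev hPort
    (deepLowerAtThreeOffKatoStratum_of_lowerHalves_of_tamDiv hGZK hMaz hL hTD hM hG hTMD)

end Summit.BirchSwinnertonDyer.BirchSwinnertonDyer.Theorems.KimAtThreeDeepLowerOffKatoStratumAssembly

end
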